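import Literature.Probability.Percolation.FourArmGarbanProofs
import Literature.Probability.Percolation.LatticePathArcs
import HarnessLib

/-!
# Garban's two-arm revealment event (Schramm–Smirnov 2011, App. B, (B.6)): the dictionary

Topic `Literature/Probability/Percolation`; support file for the named fact
`Garban2011_fourArm_multiscale` (`FourArmGarban.lean`; C. Garban, Appendix B of O. Schramm,
S. Smirnov, Ann. Probab. 39 (2011), Lemma B.1). Bond percolation on `ℤ²`.

In the proof of Lemma B.1 the revealment indicator `Y_j` ("the interface `γ` intersects `Q_j`")
is bounded through the two-arm probability, display (B.6): "Note that, by the RSW theory,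
`P[Y_j] ≲ (r/R)^{2ε}` for some positive `ε`" — an interface passing near `Q_j` has, on its two
sides, an open arm and a closed dual arm from the neighbourhood of `Q_j` to the boundary of `Q`
at distance `≳ R` (van den Berg–Nolin 2020, §5.2: "for each vertex `v` visited by `Γ` [...] it
is possible to find an open path and a closed *-path from neighbors of `v` to `∂B_{2n}`"). In
the tree the two-arm probability is that of the cluster-form event `twoArmOpenDual a b`
(`FourArmGarban.lean`: an open crossing of `A_{a,b} = {a ≤ ‖·‖_∞ ≤ b}` and no open circuit of
`A_{a,b}` around the origin), whose decay is the HYPOTHESIS of the named fact. This file proves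
the interface-free dictionary behind (B.6):

* `mem_sqAnnulusOpenCrossing_of_walk` — an open lattice walk from inside `B(a-1)` to outside
  `B(b-1)` contains an open crossing of `A_{a,b}` from `‖·‖_∞ = a` to `‖·‖_∞ = b` (first exit,
  last entry: `exists_prefix_exit`);
* `not_mem_openCircuitInAnnulus_of_dualWalk` — **a closed dual arm across `A_{a,b}` excludes an
  open circuit of `A_{a,b}` around the origin**: the `(1/2,1/2)`-shifted trace of a walk of dual
  vertices from a face indexed in `B(a-1)` to a face indexed outside `B(b)`, all of whose dual
  edges cross closed primal edges (`dualConfig`), misses the trace of every open walk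
  (`disjoint_walkTrace_image_walkTrace`, `LatticePathArcs.lean`), joins the inside of an
  enclosing circuit to its outside, and is connected — contradiction (the planar argument of
  `exists_mem_support_inter_of_enclosesOrigin`, `FourArmGarbanProofs.lean`);
* `openDualArmsAt c a b` — **the two arms around a lattice point `c`** (open arm from
  `c + B(a-1)` to outside `c + B(b-1)`, closed dual arm from a face indexed in `c + B(a-1)` to a
  face indexed outside `c + B(b)`), the interface-free superset of Garban's `{Y_j = 1}`;
  `openDualArmsAt_zero_subset` (`⊆ twoArmOpenDual a b` at `c = 0`), transport by translations
  (`dualEdge_map_shift`, `map_shift_mem_dualConfig_relabel_iff`,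
  `relabel_shift_mem_openDualArmsAt`) and the probability bound
  `real_le_twoArmOpenDual_of_subset_openDualArmsAt`: **`P_p(V) ≤ P_p(twoArmOpenDual a b)` for
  every event `V ⊆ openDualArmsAt c a b`** — the form consumed by the field `reveal` of
  `GarbanScheme` (`FourArmGarbanAssembly.lean`).

## References

* O. Schramm, S. Smirnov (appendix by C. Garban), Ann. Probab. 39 (2011), Appendix B, proof of
  Lemma B.1, (B.6) [SchrammSmirnov2011].
* J. van den Berg, P. Nolin, Progr. Probab. 77 (2020), §5.2 (two arms from visited vertices)
  [VandenbergNolin2020].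
* B. Bollobás, O. Riordan, *Percolation* (2006), Ch. 3 §1 (the dual lattice `ℤ² + (1/2,1/2)`)
  [BollobasRiordan2006].

Tree: `siteSphere`, `sqAnnulus`, `sqAnnulusOpenCrossing`, `openCircuitInAnnulus`,
`twoArmOpenDual` (`FourArmGarban.lean`), `coordVec_bounds_of_mem_edgeTrace`, `mem_siteSphere_iff`
(`FourArmGarbanProofs.lean`), `dualConfig`, `dualEdge`, `dualEdge_of_not_mem`, `mem_edgeSet_zdGraph_iff` (`Crossings.lean`),
`dualOffset`, `coordVec_dualOffset`, `dualEdge_single_eq`, `disjoint_walkTrace_image_walkTrace`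
(`LatticePathArcs.lean`), `zdGraph_adj_iff`, `box_mono`, `zdShiftIso`,
`sym2Equiv`, `sym2Equiv_mem_edgeSet_iff`, `bondPercolation_real_preimage_shift`,
`mem_openConnIn_of_walk`, `openConnIn_comm`, `isPreconnected_walkTrace`,
`toComplex_start_mem_walkTrace`, `toComplex_end_mem_walkTrace`.
-/

noncomputable section

namespace Literature.Probability.Percolation

open _root_.MeasureTheory Set Metric LatticeModels

/-! ### Walk surgery: first exit from a set of sites -/

/-- **First exit.** A walk of `ℤ²` from a site of `A` to a site off `A` has an initial segment
inside `A` ending at a site `x ∈ A` adjacent, along an edge of the walk, to a site `z ∉ A`.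
[folklore] -/
theorem exists_prefix_exit {A : Set (Site 2)} {s t : Site 2} (q : (zdGraph 2).Walk s t)
    (hs : s ∈ A) (ht : t ∉ A) :
    ∃ (x z : Site 2) (q₁ : (zdGraph 2).Walk s x), (zdGraph 2).Adj x z ∧ z ∉ A ∧
      (∀ v ∈ q₁.support, v ∈ A) ∧ (∀ v ∈ q₁.support, v ∈ q.support) ∧
      (∀ e ∈ q₁.edges, e ∈ q.edges) ∧ s(x, z) ∈ q.edges := by
  induction q with
  | nil => exact absurd hs ht
  | @cons u v w h q' ih =>
    by_cases hv : v ∈ A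
    · obtain ⟨x, z, q₁, hxz, hz, hA, hsupp, hedges, hlast⟩ := ih hv ht
      refine ⟨x, z, SimpleGraph.Walk.cons h q₁, hxz, hz, ?_, ?_, ?_, ?_⟩
      · intro a ha
        rw [SimpleGraph.Walk.support_cons, List.mem_cons] at ha
        rcases ha with rfl | ha
        · exact hs
        · exact hA a ha
      · intro a ha
        rw [SimpleGraph.Walk.support_cons, List.mem_cons] at ha ⊢
        rcases ha with rfl | ha
        · exact Or.inl rfl
        · exact Or.inr (hsupp a ha)
      · intro e he
        rw [SimpleGraph.Walk.edges_cons, List.mem_cons] at he ⊢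
        rcases he with rfl | he
        · exact Or.inl rfl
        · exact Or.inr (hedges e he)
      · rw [SimpleGraph.Walk.edges_cons, List.mem_cons]
        exact Or.inr hlast
    · refine ⟨u, v, SimpleGraph.Walk.nil, h, hv, ?_, ?_, ?_, ?_⟩
      · intro a ha
        rw [SimpleGraph.Walk.support_nil, List.mem_singleton] at ha
        subst ha
        exact hs
      · intro a ha
        rw [SimpleGraph.Walk.support_nil, List.mem_singleton] at ha
        subst ha
        exact SimpleGraph.Walk.start_mem_support _
      · intro e he
        simp at he
      · rw [SimpleGraph.Walk.edges_cons, List.mem_cons]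
        exact Or.inl rfl

/-- A neighbour of a site of `B(k)` lies in `B(k+1)` (the case `d = 2` of the tree's
`mem_box_succ_of_adj`, `UniquenessInfiniteCluster.lean`, reproved here to keep the imports
light). [folklore] -/
private theorem mem_box_succ_of_adj_two {k : ℕ} {x z : Site 2} (hx : x ∈ box 2 k) (h : (zdGraph 2).Adj x z) :
    z ∈ box 2 (k + 1) := by
  rw [mem_box] at hx ⊢
  obtain ⟨j, hj | hj⟩ := (zdGraph_adj_iff x z).1 h
  · intro i
    have h2 := hx i
    have h3 : z i = x i + (Pi.single j (1 : ℤ) : Site 2) i := by rw [hj]; rfl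
    rw [Pi.single_apply] at h3
    push_cast
    split_ifs at h3 <;> omega
  · intro i
    have h2 := hx i
    have h3 : x i = z i + (Pi.single j (1 : ℤ) : Site 2) i := by rw [hj]; rfl
    rw [Pi.single_apply] at h3
    push_cast
    split_ifs at h3 <;> omega

/-! ### Open arms give open crossings of the annulus -/

/-- **An open arm contains an open crossing of `A_{a,b}`.** If an open lattice walk runs from a
site of `B(a-1)` to a site outside `B(b-1)` (`1 ≤ a ≤ b`), then the annulus
`A_{a,b} = {a ≤ ‖·‖_∞ ≤ b}` is crossed by an open path from `‖·‖_∞ = a` to `‖·‖_∞ = b`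
(stop the walk at its first visit to `‖·‖_∞ = b`, then keep the part after its last visit to
`‖·‖_∞ ≤ a - 1`). (Kesten 1982, §2.2; the "open arm" half of the two-arm event.) [folklore] -/
theorem mem_sqAnnulusOpenCrossing_of_walk {a b : ℕ} (ha : 1 ≤ a) (hab : a ≤ b)
    {ω : BondConfig (Site 2)} {u w : Site 2} (p : (zdGraph 2).Walk u w)
    (hp : ∀ e ∈ p.edges, e ∈ ω) (hu : u ∈ box 2 (a - 1)) (hw : w ∉ box 2 (b - 1)) :
    ω ∈ sqAnnulusOpenCrossing a b := by
  -- first exit from `B(b-1)`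
  have hub : u ∈ (↑(box 2 (b - 1)) : Set (Site 2)) :=
    Finset.mem_coe.2 (box_mono 2 (by omega) hu)
  obtain ⟨x, z, q₁, hxz, hz, hA, -, hE, hlast⟩ :=
    exists_prefix_exit (A := (↑(box 2 (b - 1)) : Set (Site 2))) p hub (by simpa using hw)
  have hz' : z ∉ box 2 (b - 1) := by simpa using hz
  have hzb : z ∈ box 2 b := by
    have := mem_box_succ_of_adj_two (Finset.mem_coe.1 (hA x q₁.end_mem_support)) hxz
    rwa [Nat.sub_add_cancel (ha.trans hab)] at this
  have hzs : z ∈ siteSphere b := Finset.mem_sdiff.2 ⟨hzb, hz'⟩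
  -- the open walk `u → z` inside `B(b)`
  set p₂ : (zdGraph 2).Walk u z := q₁.concat hxz with hp₂
  have hp₂s : ∀ v ∈ p₂.support, v ∈ box 2 b := by
    intro v hv
    rw [hp₂, SimpleGraph.Walk.support_concat, List.mem_append, List.mem_singleton] at hv
    rcases hv with hv | rfl
    · exact box_mono 2 (by omega) (Finset.mem_coe.1 (hA v hv))
    · exact hzb
  have hp₂e : ∀ e ∈ p₂.edges, e ∈ ω := by
    intro e he
    rw [hp₂, SimpleGraph.Walk.edges_concat, List.concat_eq_append, List.mem_append,
      List.mem_singleton] at he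
    rcases he with he | rfl
    · exact hp e (hE e he)
    · exact hp _ hlast
  -- last entry into `B(a-1)`: first exit of the reversed walk from the complement
  have hzA : z ∈ ({v | v ∉ box 2 (a - 1)} : Set (Site 2)) := fun hz'' =>
    hz' (box_mono 2 (by omega) hz'')
  have huA : u ∉ ({v | v ∉ box 2 (a - 1)} : Set (Site 2)) := fun h => h hu
  obtain ⟨x', z', q₃, hx'z', hz'', hA', hS', hE', -⟩ :=
    exists_prefix_exit (A := {v | v ∉ box 2 (a - 1)}) p₂.reverse hzA huA
  have hz'box : z' ∈ box 2 (a - 1) := not_not.1 hz''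
  have hx'a : x' ∈ box 2 a := by
    have := mem_box_succ_of_adj_two hz'box hx'z'.symm
    rwa [Nat.sub_add_cancel ha] at this
  have hx's : x' ∈ siteSphere a := Finset.mem_sdiff.2 ⟨hx'a, hA' x' q₃.end_mem_support⟩
  refine ⟨x', hx's, z, hzs, ?_⟩
  rw [openConnIn_comm]
  refine mem_openConnIn_of_walk q₃ (fun v hv => ?_) (fun e he => ?_)
  · simp only [sqAnnulus, Finset.mem_coe, mem_annulus]
    refine ⟨?_, hA' v hv⟩
    have := hS' v hv
    rw [SimpleGraph.Walk.support_reverse, List.mem_reverse] at this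
    exact hp₂s v this
  · have := hE' e he
    rw [SimpleGraph.Walk.edges_reverse, List.mem_reverse] at this
    exact hp₂e e this

/-! ### Closed dual arms exclude open circuits around the origin -/

/-- **A closed dual arm across `A_{a,b}` excludes an open circuit of `A_{a,b}` around the
origin** (`1 ≤ a ≤ b`). If a walk of the (lower-left-corner indexed) dual lattice runs from a
face indexed in `B(a-1)` to a face indexed outside `B(b)` through dual edges that all cross
CLOSED primal edges (edges of `dualConfig ω`), then `ω ∉ openCircuitInAnnulus a b`: the shifted
dual trace misses every open trace ("an open edge of `ℤ²` cannot cross an open dual edge"), it is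
connected, it starts inside the component of the origin off the circuit (the segment from `0`
to the first face centre stays in `‖·‖_∞ < a`) and ends outside it (an axis-parallel ray from
the last face centre stays in `‖·‖_∞ > b` and is unbounded). (Kesten 1982, §2.2–2.3; Bollobás–
Riordan 2006, Ch. 3 §1; the "closed dual arm" half of the two-arm event.) [folklore] -/
theorem not_mem_openCircuitInAnnulus_of_dualWalk {a b : ℕ} (ha : 1 ≤ a) (hab : a ≤ b)
    {ω : BondConfig (Site 2)} {u w : Site 2} (q : (zdGraph 2).Walk u w)
    (hq : ∀ e ∈ q.edges, e ∈ dualConfig ω) (hu : u ∈ box 2 (a - 1)) (hw : w ∉ box 2 b) :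
    ω ∉ openCircuitInAnnulus a b := by
  rintro ⟨v₀, c, -, hcs, hco, hce⟩
  have htr : ∀ z ∈ walkTrace c, (∀ k, -(b : ℝ) ≤ coordVec z k ∧ coordVec z k ≤ b) ∧
      ∃ k, (a : ℝ) ≤ coordVec z k ∨ coordVec z k ≤ -(a : ℝ) := by
    intro z hz
    obtain ⟨e, he, hze⟩ := mem_walkTrace_iff.1 hz
    exact coordVec_bounds_of_mem_edgeTrace ha (c.edges_subset_edgeSet he)
      (fun x hx => hcs x (c.mem_support_of_mem_edges he hx)) hze
  set U : Set ℂ := connectedComponentIn (walkTrace c)ᶜ (0 : ℂ) with hU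
  set Pt : ℂ := Site.toComplex u + dualOffset with hPt
  set Wt : ℂ := Site.toComplex w + dualOffset with hWt
  have ha0 : (1 : ℝ) ≤ a := by exact_mod_cast ha
  -- (A) the first face centre is enclosed
  have hPU : Pt ∈ U := by
    have hseg : segment ℝ (0 : ℂ) Pt ⊆ (walkTrace c)ᶜ := by
      intro z hz hzt
      rw [segment_eq_image] at hz
      obtain ⟨θ, ⟨hθ0, hθ1⟩, rfl⟩ := hz
      obtain ⟨-, k, hk⟩ := htr _ hzt
      have huk : -(((a - 1 : ℕ) : ℤ)) ≤ u k ∧ u k ≤ ((a - 1 : ℕ) : ℤ) := (mem_box.1 hu) k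
      have huk' : -((a : ℝ) - 1) ≤ (u k : ℝ) ∧ (u k : ℝ) ≤ (a : ℝ) - 1 := by
        have h1 : (((a - 1 : ℕ) : ℤ) : ℝ) = (a : ℝ) - 1 := by
          rw [Int.cast_natCast, Nat.cast_sub ha, Nat.cast_one]
        constructor
        · have := huk.1; have : ((-(((a - 1 : ℕ) : ℤ)) : ℤ) : ℝ) ≤ (u k : ℝ) := by exact_mod_cast this
          rw [Int.cast_neg, h1] at this; exact this
        · have := huk.2; have : (u k : ℝ) ≤ (((a - 1 : ℕ) : ℤ) : ℝ) := by exact_mod_cast this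
          rw [h1] at this; exact this
      have hcoord : coordVec ((1 - θ) • (0 : ℂ) + θ • Pt) k = θ * (u k + 1 / 2) := by
        rw [smul_zero, zero_add, coordVec_smul, hPt, coordVec_add, coordVec_toComplex,
          coordVec_dualOffset]
      rw [hcoord] at hk
      have h₂ : 0 ≤ (1 - θ) * ((a : ℝ) - 1 / 2) := mul_nonneg (sub_nonneg.2 hθ1) (by linarith)
      rcases hk with hk | hk
      · have h₁ : 0 ≤ θ * (((a : ℝ) - 1 / 2) - (u k + 1 / 2)) := mul_nonneg hθ0 (by linarith)
        nlinarith [h₁, h₂]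
      · have h₃ : 0 ≤ θ * ((u k + 1 / 2) + ((a : ℝ) - 1 / 2)) := mul_nonneg hθ0 (by linarith)
        nlinarith [h₃, h₂]
    exact (convex_segment (0 : ℂ) Pt).isPreconnected.subset_connectedComponentIn
      (left_mem_segment ℝ _ _) hseg (right_mem_segment ℝ _ _)
  -- (B) the last face centre is not enclosed
  have hWU : Wt ∉ U := by
    intro hWU
    have hw' : ∃ i, (b : ℤ) + 1 ≤ w i ∨ w i ≤ -((b : ℤ) + 1) := by
      simp only [mem_box, not_forall, not_and_or, not_le] at hw
      obtain ⟨i, hi⟩ := hw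
      exact ⟨i, by omega⟩
    obtain ⟨i, hi⟩ := hw'
    obtain ⟨s, hs1, hsw⟩ : ∃ s : ℤ, (s = 1 ∨ s = -1) ∧ (b : ℤ) + 1 ≤ s * w i := by
      rcases hi with hi | hi
      · exact ⟨1, Or.inl rfl, by omega⟩
      · exact ⟨-1, Or.inr rfl, by omega⟩
    have hsw' : (b : ℝ) + 1 ≤ (s : ℝ) * (w i : ℝ) := by exact_mod_cast hsw
    have hss : (s : ℝ) * s = 1 := by rcases hs1 with rfl | rfl <;> norm_num
    have hsabs : |(s : ℝ)| = 1 := by rcases hs1 with rfl | rfl <;> norm_num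
    set D : ℂ := Site.toComplex (Pi.single i s) with hD
    set R : Set ℂ := (fun t : ℝ => Wt + t • D) '' Ici 0 with hR
    have hcoordR : ∀ t : ℝ, (s : ℝ) * coordVec (Wt + t • D) i = s * w i + s / 2 + t := by
      intro t
      rw [coordVec_add, coordVec_smul, hWt, coordVec_add, coordVec_toComplex,
        coordVec_dualOffset, hD, coordVec_toComplex]
      simp only [Pi.single_eq_same]
      linear_combination t * hss
    have hRsub : R ⊆ (walkTrace c)ᶜ := by
      rintro _ ⟨t, ht, rfl⟩ hzt
      rw [mem_Ici] at ht
      obtain ⟨hub, -⟩ := htr _ hzt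
      have hb' := hub i
      have hkey := hcoordR t
      rcases hs1 with rfl | rfl
      · push_cast at hkey hsw'; linarith [hb'.2]
      · push_cast at hkey hsw'; linarith [hb'.1]
    have hRconn : IsPreconnected R := isPreconnected_Ici.image _ (by fun_prop)
    have hWR : Wt ∈ R := ⟨0, mem_Ici.2 le_rfl, by simp⟩
    have hRU : R ⊆ U := by
      have := hRconn.subset_connectedComponentIn hWR hRsub
      rwa [← connectedComponentIn_eq hWU] at this
    obtain ⟨C, hC⟩ := isBounded_iff_forall_norm_le.1 (hce.2.subset hRU)
    set t : ℝ := |C| + 1 with ht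
    have htR : Wt + t • D ∈ R := ⟨t, mem_Ici.2 (by positivity), rfl⟩
    have h1 : t ≤ ‖Wt + t • D‖ := by
      have hle := abs_coordVec_le_norm (Wt + t • D) i
      have hkey := hcoordR t
      have habs : |(s : ℝ) * coordVec (Wt + t • D) i| = |coordVec (Wt + t • D) i| := by
        rw [abs_mul, hsabs, one_mul]
      have h2 : (s : ℝ) * coordVec (Wt + t • D) i ≤ |coordVec (Wt + t • D) i| := by
        rw [← habs]; exact le_abs_self _
      have hs2 : -(1 : ℝ) ≤ s := by rcases hs1 with rfl | rfl <;> norm_num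
      have hb0 : (0 : ℝ) ≤ b := by positivity
      linarith
    have h2 := hC _ htR
    have h3 : C < t := by rw [ht]; linarith [le_abs_self C]
    linarith
  -- (C) the shifted dual trace joins them off the trace of the circuit
  by_cases hqn : q.Nil
  · cases hqn
    exact hw (box_mono 2 (by omega) hu)
  · have hT : (· + dualOffset) '' walkTrace q ⊆ (walkTrace c)ᶜ :=
      (disjoint_walkTrace_image_walkTrace hco hq).symm.subset_compl_right
    have hTc : IsPreconnected ((· + dualOffset) '' walkTrace q) :=
      (isPreconnected_walkTrace q).image _ (by fun_prop)
    have hPT : Pt ∈ (· + dualOffset) '' walkTrace q := ⟨_, toComplex_start_mem_walkTrace hqn, rfl⟩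
    have hWT : Wt ∈ (· + dualOffset) '' walkTrace q := ⟨_, toComplex_end_mem_walkTrace hqn, rfl⟩
    have hsub : (· + dualOffset) '' walkTrace q ⊆ U := by
      have := hTc.subset_connectedComponentIn hPT hT
      rwa [← connectedComponentIn_eq hPU] at this
    exact hWU (hsub hWT)

/-! ### The two arms around a lattice point -/

/-- **Garban's revealment superset: two arms around `c`.** An open lattice walk from a site of
`c + B(a-1)` to a site outside `c + B(b-1)`, and a walk of dual vertices (faces indexed by
lower-left corners) from a face indexed in `c + B(a-1)` to a face indexed outside `c + B(b)`
all of whose dual edges cross closed primal edges. This is what an exploration interface passing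
within `c + B(a-1)` and reaching sup-distance `> b` from `c` provides (open edges on one side,
closed on the other); at `c = 0` it implies the two-arm event `twoArmOpenDual a b`
(`openDualArmsAt_zero_subset`). (Schramm–Smirnov 2011, App. B, (B.6); van den Berg–Nolin 2020,
§5.2.) [cite: SchrammSmirnov2011, Appendix B, proof of Lemma B.1, (B.6)] -/
def openDualArmsAt (c : Site 2) (a b : ℕ) : Set (BondConfig (Site 2)) :=
  {ω | (∃ (u w : Site 2) (p : (zdGraph 2).Walk u w),
      u - c ∈ box 2 (a - 1) ∧ w - c ∉ box 2 (b - 1) ∧ ∀ e ∈ p.edges, e ∈ ω) ∧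
    ∃ (u w : Site 2) (q : (zdGraph 2).Walk u w),
      u - c ∈ box 2 (a - 1) ∧ w - c ∉ box 2 b ∧ ∀ e ∈ q.edges, e ∈ dualConfig ω}

/-- **At the origin the two arms give the two-arm event**: `openDualArmsAt 0 a b ⊆
twoArmOpenDual a b` for `1 ≤ a ≤ b`. [cite: SchrammSmirnov2011, Appendix B, proof of Lemma B.1, (B.6)] -/
theorem openDualArmsAt_zero_subset {a b : ℕ} (ha : 1 ≤ a) (hab : a ≤ b) :
    openDualArmsAt 0 a b ⊆ twoArmOpenDual a b := by
  rintro ω ⟨⟨u, w, p, hu, hw, hp⟩, ⟨u', w', q, hu', hw', hq⟩⟩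
  rw [sub_zero] at hu hw hu' hw'
  exact ⟨mem_sqAnnulusOpenCrossing_of_walk ha hab p hp hu hw,
    not_mem_openCircuitInAnnulus_of_dualWalk ha hab q hq hu' hw'⟩

/-- **Duality commutes with translations**: `dualEdge (e + v) = dualEdge e + v` (on lattice
edges by the explicit formulas, off the edge set both sides are the junk identity). [folklore] -/
theorem dualEdge_map_shift (v : Site 2) (e : Sym2 (Site 2)) :
    dualEdge (Sym2.map (Site.shift v) e) = Sym2.map (Site.shift v) (dualEdge e) := by
  by_cases he : e ∈ (zdGraph 2).edgeSet
  · obtain ⟨u, i, rfl⟩ := mem_edgeSet_zdGraph_iff.1 he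
    have h1 : Sym2.map (Site.shift v) s(u, u + Pi.single i 1) =
        s(u + v, (u + v) + Pi.single i 1) := by
      rw [Sym2.map_mk, Site.shift_apply, Site.shift_apply, add_right_comm]
    have hij : i ≠ i + 1 := by fin_cases i <;> decide
    rw [h1, dualEdge_single_eq hij, dualEdge_single_eq hij, Sym2.map_mk, Site.shift_apply,
      Site.shift_apply, add_sub_right_comm]
  · have he' : Sym2.map (Site.shift v) e ∉ (zdGraph 2).edgeSet := fun h =>
      he ((sym2Equiv_mem_edgeSet_iff (zdShiftIso v) e).1 h)
    rw [dualEdge_of_not_mem he, dualEdge_of_not_mem he']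

/-- **The dual configuration of a translate is the translate of the dual configuration**
(membership form): `e + v` is dual-open for `ω + v` iff `e` is dual-open for `ω`. [folklore] -/
theorem map_shift_mem_dualConfig_relabel_iff (v : Site 2) (ω : BondConfig (Site 2))
    (d : Sym2 (Site 2)) :
    Sym2.map (Site.shift v) d ∈ dualConfig (BondConfig.relabel (sym2Equiv (Site.shift v)) ω) ↔
      d ∈ dualConfig ω := by
  simp only [mem_dualConfig_iff, BondConfig.relabel_apply, Set.mem_image, sym2Equiv_apply]
  constructor
  · rintro ⟨hE, hne⟩
    refine ⟨(sym2Equiv_mem_edgeSet_iff (zdShiftIso v) d).1 hE, fun e he heq => ?_⟩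
    refine hne (Sym2.map (Site.shift v) e) ⟨e, he, rfl⟩ ?_
    rw [dualEdge_map_shift, heq]
  · rintro ⟨hE, hne⟩
    refine ⟨(sym2Equiv_mem_edgeSet_iff (zdShiftIso v) d).2 hE, ?_⟩
    rintro _ ⟨e, he, rfl⟩ heq
    rw [dualEdge_map_shift] at heq
    exact hne e he (Sym2.map.injective (Site.shift v).injective heq)

/-- **Transport of the two arms by translation**: shifting the configuration by `v` carries the
two arms around `c` to two arms around `c + v`. [folklore] -/
theorem relabel_shift_mem_openDualArmsAt {c v : Site 2} {a b : ℕ} {ω : BondConfig (Site 2)}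
    (h : ω ∈ openDualArmsAt c a b) :
    BondConfig.relabel (sym2Equiv (Site.shift v)) ω ∈ openDualArmsAt (c + v) a b := by
  obtain ⟨⟨u, w, p, hu, hw, hp⟩, ⟨u', w', q, hu', hw', hq⟩⟩ := h
  have hshift : ∀ x : Site 2, (zdShiftIso v).toHom x - (c + v) = x - c := fun x => by
    show x + v - (c + v) = x - c
    abel
  refine ⟨⟨(zdShiftIso v).toHom u, (zdShiftIso v).toHom w, p.map (zdShiftIso v).toHom,
      by rwa [hshift], by rwa [hshift], ?_⟩,
    ⟨(zdShiftIso v).toHom u', (zdShiftIso v).toHom w', q.map (zdShiftIso v).toHom,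
      by rwa [hshift], by rwa [hshift], ?_⟩⟩
  · intro e he
    rw [SimpleGraph.Walk.edges_map, List.mem_map] at he
    obtain ⟨e₀, he₀, rfl⟩ := he
    show Sym2.map (Site.shift v) e₀ ∈ _
    rw [BondConfig.mem_relabel_iff, sym2Equiv_symm, sym2Equiv_apply, Sym2.map_map,
      Equiv.symm_comp_self, Sym2.map_id, id]
    exact hp e₀ he₀
  · intro e he
    rw [SimpleGraph.Walk.edges_map, List.mem_map] at he
    obtain ⟨e₀, he₀, rfl⟩ := he
    show Sym2.map (Site.shift v) e₀ ∈ dualConfig _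
    rw [map_shift_mem_dualConfig_relabel_iff]
    exact hq e₀ he₀

/-- **Two arms around `c` are a translate of the two-arm event**: `openDualArmsAt c a b ⊆
(· - c) ⁻¹' twoArmOpenDual a b`. [cite: SchrammSmirnov2011, Appendix B, proof of Lemma B.1, (B.6)] -/
theorem openDualArmsAt_subset_preimage_twoArmOpenDual {a b : ℕ} (ha : 1 ≤ a) (hab : a ≤ b)
    (c : Site 2) :
    openDualArmsAt c a b ⊆
      BondConfig.relabel (sym2Equiv (Site.shift (-c))) ⁻¹' twoArmOpenDual a b := by
  intro ω hω
  have := relabel_shift_mem_openDualArmsAt (v := -c) hω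
  rw [add_neg_cancel] at this
  exact openDualArmsAt_zero_subset ha hab this

/-- **The revealment bound in the form of `GarbanScheme.reveal`**: every event contained in the
two arms around `c` has `P_p`-probability at most `π₂(a, b) = P_p(twoArmOpenDual a b)`
(translation invariance of `P_p`). (Schramm–Smirnov 2011, App. B, (B.6), with the two-arm
probability left symbolic; the decay `≲ (a/b)^{2ε}` is the hypothesis of Lemma B.1 in van den
Berg–Nolin's form.) [cite: SchrammSmirnov2011, Appendix B, proof of Lemma B.1, (B.6)] -/
theorem real_le_twoArmOpenDual_of_subset_openDualArmsAt (p : unitInterval) {a b : ℕ}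
    (ha : 1 ≤ a) (hab : a ≤ b) {c : Site 2} {V : Set (BondConfig (Site 2))}
    (hV : V ⊆ openDualArmsAt c a b) :
    (bondPercolation (zdGraph 2) p).real V ≤
      (bondPercolation (zdGraph 2) p).real (twoArmOpenDual a b) := by
  calc (bondPercolation (zdGraph 2) p).real V
      ≤ (bondPercolation (zdGraph 2) p).real
          (BondConfig.relabel (sym2Equiv (Site.shift (-c))) ⁻¹' twoArmOpenDual a b) :=
        measureReal_mono (hV.trans (openDualArmsAt_subset_preimage_twoArmOpenDual ha hab c))
    _ = (bondPercolation (zdGraph 2) p).real (twoArmOpenDual a b) :=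
        bondPercolation_real_preimage_shift (-c) p _

end Literature.Probability.Percolation
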